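import Summits.HodgeConjecture.HodgeConjecture.Theorems.PeriodDeficiencyQbarGenericIsHodgeGenericReduction
import Summits.HodgeConjecture.HodgeConjecture.Theorems.PeriodDeficiencyQbarGenericIsHodgeGenericStubFiberOverConjPointIso
import Summits.HodgeConjecture.HodgeConjecture.Theorems.PeriodDeficiencyQbarGenericIsHodgeGenericStubMtRankHodgeEqOfIso
import Literature.AlgebraicGeometry.Motives.SpecialSubvarietiesCountable
import Literature.AlgebraicGeometry.HodgeTheory.HodgeGenericQbarDescent
import Literature.AlgebraicGeometry.HodgeTheory.QbarFamilyLocalSystem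
import Literature.AlgebraicGeometry.Motives.BaseChangeProofs
import Literature.AlgebraicGeometry.Motives.MumfordTateRankInvariance
import HarnessLib

/-!
# Crux `QbarGenericIsHodgeGeneric` (HGQ, stmt-HodgeConjecture-11595), route `PeriodDeficiency`:
# HGQ ⟺ its family-free open core, modulo the named Cattani–Deligne–Kaplan countability fact

Sorry-free extract of the line skeleton `Cruxes/QbarGenericIsHodgeGeneric/Lines/birth.lean`, part 2 of 2
(part 1: `…QbarGenericIsHodgeGenericReduction`, HGQ ⟸ rank invariance ∧ countability). Here the two
hypotheses of part 1 are instantiated: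

* countability of the special subvarieties meeting an affine chart of `S₀` is the named Literature fact
  `Motives.countable_specialSubvarieties_meeting_affineOpen` (Cattani–Deligne–Kaplan 1995 Thm. 1.1 /
  Cor. 1.2 with Baldi–Klingler–Ullmo 2024 Def. 3.3, §3.4, Lemma 3.6; unproved `def … : Prop`) applied
  to the complexified family over the affine open `U₀ ⊗_σ ℂ` (`countable_special_chart_of_fact`);
* Mumford–Tate rank invariance under `Aut(ℂ/ℚ̄)` on fibres of `ℚ̄`-families follows from its
  **family-free core** — for `B` classical, `τ ∈ Aut(ℂ/σℚ̄)` and `X` smooth projective over `ℂ`,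
  `dim MT(Hⁱ(X^τ)) = dim MT(Hⁱ(X))` (`X^τ = Motives.conjugateVariety τ X`) — through the landed stubs
  "fibre over `τ · y` ≅ `(𝒳_y)^τ`" (`stub_fiberOver_conjPoint_iso`) and "`mtRank ∘ B.hodge` is invariant
  under `ℂ`-isomorphisms" (`stub_mtRank_hodge_eq_of_iso`) (`mtRankAt_conjPoint_of_core`).

Main theorems: `qbarGenericIsHodgeGeneric_of_core` — **HGQ ⟸ (CDK countability fact) ∧ (family-free
core)** — and conversely `core_of_qbarGenericIsHodgeGeneric` — **HGQ ⟹ the family-free core**, given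
spreading out (`HodgeTheory.spreadingOut_smoothProjective_qbarFamily`, a named fact: EGA IV₃ 8.8.2 /
Charles–Schnell §11.3.5) and the existence of geometric VHS data on smooth projective `ℚ̄`-families (the
existence clause of the route support `ClassicalGeometricVHS`, stmt-HodgeConjecture-11597). So, modulo
known mathematics, HGQ is EQUIVALENT to the family-free core, which on paper is open: it follows from
Deligne's "Hodge classes are absolute Hodge" (proved for abelian varieties, Deligne 1982 I Thm. 2.11, and
for `H²` of hyperkähler varieties, André 1996) and is not known otherwise.

## References
* [KlinglerOtwinowskaUrbanik2023] Klingler–Otwinowska–Urbanik, Ann. Sci. ÉNS 56 (2023), §1.2, Conj. 1.5.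
* [BaldiKlinglerUllmo2024] Baldi–Klingler–Ullmo, Invent. Math. 235 (2024), Def. 3.3, §3.4, Lemma 3.6.
* [CattaniDeligneKaplan1995JAMS] Cattani–Deligne–Kaplan, JAMS 8 (1995), Thm. 1.1, Cor. 1.2.
* [Deligne1982HodgeCycles] Deligne, LNM 900 (1982), I §2 and Thm. 2.11.
* [Andre1996Motifs] André, Publ. Math. IHÉS 83 (1996), Thm. 0.6.2.
* [CharlesSchnell2014Notes] Charles–Schnell, Notes on absolute Hodge classes, §11.3.5.
-/

noncomputable section

-- every declaration of this problem lives in `Summit.HodgeConjecture.HodgeConjecture.…` (problem = summit)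
set_option linter.dupNamespace false

namespace Summit.HodgeConjecture.HodgeConjecture.Theorems

open CategoryTheory AlgebraicGeometry
open Literature.AlgebraicGeometry.Motives Literature.AlgebraicGeometry.HodgeTheory
open Summit.HodgeConjecture.HodgeConjecture.Theses.PeriodDeficiency (QbarGenericIsHodgeGeneric)

/-! ### Countability on a chart of `S₀` from the named fact -/

/-- **The special subvarieties of `S = S₀ ⊗_σ ℂ` meeting an affine chart `U₀` of `S₀` are countably
many**, from the named fact `countable_specialSubvarieties_meeting_affineOpen` at the complexified family
over `S₀ ⊗_σ ℂ` — smooth (`HodgeTheory.smooth_baseChangeHom_hom`) and irreducible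
(`HodgeTheory.irreducibleSpace_baseChangeHom_left`) — and the affine open `π⁻¹U₀ = U₀ ⊗_σ ℂ` (`π` is
affine, a base change of `Spec ℂ ⟶ Spec ℚ̄`; Mathlib `IsAffineOpen.preimage`).
[cite: BaldiKlinglerUllmo2024, Def. 3.3, §3.4 and Lemma 3.6] -/
theorem countable_special_chart_of_fact (h : countable_specialSubvarieties_meeting_affineOpen) :
    ∀ (B : BettiHodgeData ℂ), B.IsClassical → ∀ [HodgeTensorFacts.{0, 0}]
      (σ : AlgebraicClosure ℚ →+* ℂ) ⦃𝒳₀ S₀ : SchemeOver (AlgebraicClosure ℚ)⦄ (f₀ : 𝒳₀ ⟶ S₀)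
      (n i : ℕ) (D : GeometricVHSData B ((baseChangeHom σ).map f₀) n i)
      [∀ s, Module.Finite ℚ (D.V.fiber s)],
      IrreducibleSpace S₀.left → AlgebraicGeometry.Smooth S₀.hom →
      ∀ U₀ : S₀.left.Opens, IsAffineOpen U₀ →
        {Y : Set (ComplexPoints ((baseChangeHom σ).obj S₀)) | D.IsSpecialSubvariety Y ∧
          ∃ y ∈ Y, (baseChangeHomFst σ S₀).base y.pt ∈ U₀}.Countable := by
  intro B hB _ σ 𝒳₀ S₀ f₀ n i D _ hirr hsm U₀ hU₀
  haveI := hirr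
  haveI := hsm
  haveI : IrreducibleSpace ((baseChangeHom σ).obj S₀).left := irreducibleSpace_baseChangeHom_left σ
  haveI : IsAffineHom (baseChangeHomFst σ S₀) :=
    MorphismProperty.pullback_fst (P := @IsAffineHom) _ _ inferInstance
  exact h B hB ((baseChangeHom σ).map f₀) n i D inferInstance (smooth_baseChangeHom_hom σ)
    ((baseChangeHomFst σ S₀) ⁻¹ᵁ U₀) (hU₀.preimage _)

/-! ### Rank invariance on fibres from the family-free core -/

/-- **Mumford–Tate rank invariance under `Aut(ℂ/ℚ̄)` on a `ℚ̄`-family, from the family-free core**: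
`D.mtRankAt` is `mtRank` of `B.hodge` of the fibre (`GeometricVHSData.mtRankAt_eq_mtRank_hodge`); the
fibre over `τ · y` is `≅ (𝒳_y)^τ` (`stub_fiberOver_conjPoint_iso`); ranks are invariant under
isomorphisms (`stub_mtRank_hodge_eq_of_iso`); and `(𝒳_y)^τ`, `𝒳_y` have equal ranks by the core.
[cite: KlinglerOtwinowskaUrbanik2023, §1.2] -/
theorem mtRankAt_conjPoint_of_core
    (hcore : ∀ (B : BettiHodgeData ℂ), B.IsClassical → ∀ [HodgeTensorFacts.{0, 0}]
      (σ : AlgebraicClosure ℚ →+* ℂ) (τ : ringAutOver σ) ⦃n : ℕ⦄ ⦃X : SchemeOver ℂ⦄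
      (hX : IsSmoothProjective n X) (i : ℕ) [Module.Finite ℚ (B.W.obj X i)]
      [Module.Finite ℚ (B.W.obj (conjugateVariety
        (@AlgEquiv.toRingEquiv (AlgebraicClosure ℚ) ℂ ℂ _ _ _ σ.toAlgebra σ.toAlgebra τ) X) i)],
      (B.hodge (IsSmoothProjective.conjugateVariety_holds
        (@AlgEquiv.toRingEquiv (AlgebraicClosure ℚ) ℂ ℂ _ _ _ σ.toAlgebra σ.toAlgebra τ) hX) i).mtRank =
        (B.hodge hX i).mtRank) :
    ∀ (B : BettiHodgeData ℂ), B.IsClassical → ∀ [HodgeTensorFacts.{0, 0}]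
      (σ : AlgebraicClosure ℚ →+* ℂ) ⦃𝒳₀ S₀ : SchemeOver (AlgebraicClosure ℚ)⦄ (f₀ : 𝒳₀ ⟶ S₀)
      (n i : ℕ) (D : GeometricVHSData B ((baseChangeHom σ).map f₀) n i)
      [∀ s, Module.Finite ℚ (D.V.fiber s)],
      IrreducibleSpace S₀.left → AlgebraicGeometry.Smooth S₀.hom →
      ∀ (τ : ringAutOver σ) (y : ComplexPoints ((baseChangeHom σ).obj S₀)),
        D.mtRankAt (conjPoint σ S₀ τ y) = D.mtRankAt y := by
  intro B hB _ σ 𝒳₀ S₀ f₀ n i D _ _ _ τ y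
  obtain ⟨e⟩ := stub_fiberOver_conjPoint_iso σ f₀ τ y
  haveI := D.finite_W_fiberOver y
  haveI := D.finite_W_fiberOver (conjPoint σ S₀ τ y)
  have hXτ := IsSmoothProjective.conjugateVariety_holds
    (@AlgEquiv.toRingEquiv (AlgebraicClosure ℚ) ℂ ℂ _ _ _ σ.toAlgebra σ.toAlgebra τ)
    (D.isSmoothProjective_fiberOver y)
  haveI : Module.Finite ℚ (B.W.obj (conjugateVariety
      (@AlgEquiv.toRingEquiv (AlgebraicClosure ℚ) ℂ ℂ _ _ _ σ.toAlgebra σ.toAlgebra τ)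
      (fiberOver ((baseChangeHom σ).map f₀) y)) i) := B.W.finite_obj hXτ i
  rw [D.mtRankAt_eq_mtRank_hodge, D.mtRankAt_eq_mtRank_hodge,
    stub_mtRank_hodge_eq_of_iso B e (D.isSmoothProjective_fiberOver _) hXτ i,
    hcore B hB σ τ (D.isSmoothProjective_fiberOver y) i]

/-! ### HGQ from the named fact and the family-free core -/

/-- **HGQ ⟸ (Cattani–Deligne–Kaplan countability, named fact) ∧ (family-free core
`dim MT(Hⁱ(X^τ)) = dim MT(Hⁱ(X))`)**: `qbarGenericIsHodgeGeneric_of_rankInvariance_of_countable` (part 1)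
with `mtRankAt_conjPoint_of_core` and `countable_special_chart_of_fact`. This is the line `birth` of the
crux closed modulo exactly one named published theorem and one open, family-free statement.
[cite: KlinglerOtwinowskaUrbanik2023, §1.2 and Conj. 1.5(a)] -/
theorem qbarGenericIsHodgeGeneric_of_core :
    countable_specialSubvarieties_meeting_affineOpen →
    (∀ (B : BettiHodgeData ℂ), B.IsClassical → ∀ [HodgeTensorFacts.{0, 0}]
      (σ : AlgebraicClosure ℚ →+* ℂ) (τ : ringAutOver σ) ⦃n : ℕ⦄ ⦃X : SchemeOver ℂ⦄
      (hX : IsSmoothProjective n X) (i : ℕ) [Module.Finite ℚ (B.W.obj X i)]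
      [Module.Finite ℚ (B.W.obj (conjugateVariety
        (@AlgEquiv.toRingEquiv (AlgebraicClosure ℚ) ℂ ℂ _ _ _ σ.toAlgebra σ.toAlgebra τ) X) i)],
      (B.hodge (IsSmoothProjective.conjugateVariety_holds
        (@AlgEquiv.toRingEquiv (AlgebraicClosure ℚ) ℂ ℂ _ _ _ σ.toAlgebra σ.toAlgebra τ) hX) i).mtRank =
        (B.hodge hX i).mtRank) →
    QbarGenericIsHodgeGeneric := by
  intro hfact hcore
  exact qbarGenericIsHodgeGeneric_of_rankInvariance_of_countable (mtRankAt_conjPoint_of_core hcore)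
    (countable_special_chart_of_fact hfact)

/-! ### Tightness: HGQ implies the family-free core -/

/-- **HGQ implies the family-free core on fibres of `ℚ̄`-families**: for `y ∈ S(ℂ)`,
`dim MT(Hⁱ((𝒳_y)^τ)) = dim MT(Hⁱ(𝒳_y))` — rank invariance
(`mtRankAt_conjPoint_of_qbarGenericIsHodgeGeneric`, part 1) read through
`GeometricVHSData.mtRankAt_eq_mtRank_hodge`, `stub_fiberOver_conjPoint_iso` and
`stub_mtRank_hodge_eq_of_iso`. [folklore] -/
theorem mtRank_hodge_conjugateVariety_fiberOver_of_qbarGenericIsHodgeGeneric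
    (h : QbarGenericIsHodgeGeneric) (B : BettiHodgeData ℂ) (hB : B.IsClassical) [HodgeTensorFacts.{0, 0}]
    (σ : AlgebraicClosure ℚ →+* ℂ) ⦃𝒳₀ S₀ : SchemeOver (AlgebraicClosure ℚ)⦄ (f₀ : 𝒳₀ ⟶ S₀)
    (n i : ℕ) (D : GeometricVHSData B ((baseChangeHom σ).map f₀) n i)
    [∀ s, Module.Finite ℚ (D.V.fiber s)] (hirr : IrreducibleSpace S₀.left)
    (hsm : AlgebraicGeometry.Smooth S₀.hom) (τ : ringAutOver σ)
    (y : ComplexPoints ((baseChangeHom σ).obj S₀))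
    [Module.Finite ℚ (B.W.obj (fiberOver ((baseChangeHom σ).map f₀) y) i)]
    [Module.Finite ℚ (B.W.obj (conjugateVariety
      (@AlgEquiv.toRingEquiv (AlgebraicClosure ℚ) ℂ ℂ _ _ _ σ.toAlgebra σ.toAlgebra τ)
      (fiberOver ((baseChangeHom σ).map f₀) y)) i)] :
    (B.hodge (IsSmoothProjective.conjugateVariety_holds
        (@AlgEquiv.toRingEquiv (AlgebraicClosure ℚ) ℂ ℂ _ _ _ σ.toAlgebra σ.toAlgebra τ)
        (D.isSmoothProjective_fiberOver y)) i).mtRank =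
      (B.hodge (D.isSmoothProjective_fiberOver y) i).mtRank := by
  have hinv := mtRankAt_conjPoint_of_qbarGenericIsHodgeGeneric h B hB σ f₀ n i D hirr hsm τ y
  obtain ⟨e⟩ := stub_fiberOver_conjPoint_iso σ f₀ τ y
  haveI := D.finite_W_fiberOver (conjPoint σ S₀ τ y)
  rw [D.mtRankAt_eq_mtRank_hodge, D.mtRankAt_eq_mtRank_hodge,
    stub_mtRank_hodge_eq_of_iso B e (D.isSmoothProjective_fiberOver _)
      (IsSmoothProjective.conjugateVariety_holds _ (D.isSmoothProjective_fiberOver y)) i] at hinv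
  convert hinv using 2

/-- **HGQ implies the family-free core**, given spreading out (`spreadingOut_smoothProjective_qbarFamily`:
every smooth projective complex `X` is a fibre `𝒳_s` of a smooth projective `ℚ̄`-family over a smooth
irreducible base) and the existence of geometric VHS data with finite-dimensional fibres on such
families (existence clause of the route support `ClassicalGeometricVHS`): `X ≅ 𝒳_s` and
`X^τ ≅ (𝒳_s)^τ` (functoriality of `conjugateVariety τ = (baseChangeHom τ).obj`), and
`stub_mtRank_hodge_eq_of_iso` transports the fibre statement. Together with
`qbarGenericIsHodgeGeneric_of_core`: modulo known mathematics (the landed stubs, the named facts and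
that existence support) HGQ is EQUIVALENT to its family-free core. [folklore] -/
theorem core_of_qbarGenericIsHodgeGeneric :
    spreadingOut_smoothProjective_qbarFamily →
    (∀ (B : BettiHodgeData ℂ), B.IsClassical → ∀ (σ : AlgebraicClosure ℚ →+* ℂ)
      ⦃𝒳₀ S₀ : SchemeOver (AlgebraicClosure ℚ)⦄ (f₀ : 𝒳₀ ⟶ S₀) (n i : ℕ),
      IsSmoothProjectiveFamily ((baseChangeHom σ).map f₀) n → IrreducibleSpace S₀.left →
      AlgebraicGeometry.Smooth S₀.hom →
      ∃ D : GeometricVHSData B ((baseChangeHom σ).map f₀) n i, ∀ s, Module.Finite ℚ (D.V.fiber s)) →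
    QbarGenericIsHodgeGeneric →
    ∀ (B : BettiHodgeData ℂ), B.IsClassical → ∀ [HodgeTensorFacts.{0, 0}]
      (σ : AlgebraicClosure ℚ →+* ℂ) (τ : ringAutOver σ) ⦃n : ℕ⦄ ⦃X : SchemeOver ℂ⦄
      (hX : IsSmoothProjective n X) (i : ℕ) [Module.Finite ℚ (B.W.obj X i)]
      [Module.Finite ℚ (B.W.obj (conjugateVariety
        (@AlgEquiv.toRingEquiv (AlgebraicClosure ℚ) ℂ ℂ _ _ _ σ.toAlgebra σ.toAlgebra τ) X) i)],
      (B.hodge (IsSmoothProjective.conjugateVariety_holds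
        (@AlgEquiv.toRingEquiv (AlgebraicClosure ℚ) ℂ ℂ _ _ _ σ.toAlgebra σ.toAlgebra τ) hX) i).mtRank =
        (B.hodge hX i).mtRank := by
  intro hsp hex h B hB _ σ τ n X hX i _ _
  set τ' : ℂ ≃+* ℂ := @AlgEquiv.toRingEquiv (AlgebraicClosure ℚ) ℂ ℂ _ _ _ σ.toAlgebra σ.toAlgebra τ
    with hτ'
  -- spread `X` out: `X ≅ 𝒳_s` for a smooth projective `ℚ̄`-family over a smooth irreducible base
  obtain ⟨𝒳₀, S₀, f₀, s, -, -, hirr, hsm, hf, -, ⟨e⟩⟩ := hsp σ hX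
  obtain ⟨D, hD⟩ := hex B hB σ f₀ n i hf hirr hsm
  haveI := hD
  haveI := D.finite_W_fiberOver s
  have hXs := D.isSmoothProjective_fiberOver s
  have hXsτ := IsSmoothProjective.conjugateVariety_holds τ' hXs
  haveI : Module.Finite ℚ (B.W.obj (conjugateVariety τ' (fiberOver ((baseChangeHom σ).map f₀) s)) i) :=
    B.W.finite_obj hXsτ i
  -- `X^τ ≅ (𝒳_s)^τ`
  have eτ : conjugateVariety τ' X ≅ conjugateVariety τ' (fiberOver ((baseChangeHom σ).map f₀) s) :=
    (baseChangeHom τ'.toRingHom).mapIso e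
  rw [stub_mtRank_hodge_eq_of_iso B eτ (IsSmoothProjective.conjugateVariety_holds τ' hX) hXsτ i,
    stub_mtRank_hodge_eq_of_iso B e hX hXs i]
  exact mtRank_hodge_conjugateVariety_fiberOver_of_qbarGenericIsHodgeGeneric h B hB σ f₀ n i D hirr hsm τ s

end Summit.HodgeConjecture.HodgeConjecture.Theorems

end
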